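import Summits.QuantumFields.YangMills.Theorems.UnitScaleTiltProp7CurrentSlavingFlat
import Summits.QuantumFields.YangMills.Theorems.UnitScaleTiltProp7FlatCoercivityR
import Literature.MathematicalPhysics.QuantumFieldTheory.Balaban1983to89.B10Eq68TorusRegularity
import HarnessLib

/-!
# Route `UnitScaleTilt`, crux K1 child «MinimiserStabilityRegPr» (stmt-QuantumFields-19200), registered stub `stub_prop7From14` (V3, skeleton v7
# cc37a1787726) — lane B: **THE CURRENT IS SLAVED TO THE CURVATURE UNDER THE EULER–LAGRANGE PORT** — for a unitary-valued `V` in ANY presentation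
# (`a = sup‖V − 1‖`, `f = sup‖V(∂p) − 1‖`) and a real component `ℓ` of the covariant divergence of the curvature `J = D^{1*}_V∂V` whose scaled values
# `c²ℓ(J)` (`c = L^k`) lie within `p` of a flat multiplier current `Q*ω` (the E–L ∕ port defect of `Prop7FlatSliceRegularityGauge`):
# `sup|c²ℓ(J)| ≤ 12·c²·f·(c⁻¹ + a) + 4p` — the divergence member of [Balaban1985Variational] (2) follows from the plaquette member, one power of
# `L^{−k}` gained, with NO Green's function, NO gauge condition, NO decay, uniformly in `k` and in the volume

Cell `ym3-torus` ∕ fleet seat `ym-ust-19200-p3` (WIDTH-LEVER lane B of V3 «regularity of the minimiser straight from the Euler–Lagrange system»;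
HUMAN RULING D-0037, YM ladder rung R3).  `--supports stmt-QuantumFields-19200 --as helper`.  Sequel of `UnitScaleTiltProp7CurrentSlavingFlat`
(tent-Stokes telescoping, the diagonally dominant normal operator, the V1 dictionary).

WHY.  Print's regular space (2)∕(6) ([Balaban1985Variational] p. 278) has TWO members: small plaquette variables `|U(∂p) − 1| < ε₀η²` and small
covariant divergence `|(D*∂U)(b)| < ε₀η³` (`η = L^{−k}`); the second is the Yang–Mills CURRENT `J`.  For a critical configuration the Euler–Lagrange
equation says that `J` is a constraint force — a multiplier current of the block averaging ((127)∕(133) p. 297–298, (158) p. 302); a multiplier current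
is a tent interpolation `Q_k^⊤λ` of coarse data, bounded by three times its own block averages (prequel §4); and the block average of the covariant
divergence of the curvature TELESCOPES across the block to two boundary layers up to conjugation defects `2a·f` per term (§3 here):
`|Q_k(ℓ∘D^{1*}_V∂V)(c)| ≤ (d − 1)·Λ·f·(2(L^k)⁻¹ + 2a)`.  Together: the current is bounded by `O(L^{−k} + a)·f` plus the port defect — the divergence
member of (2) is SLAVED to the plaquette member for (port-)critical configurations; in a block-axial presentation `a ≤ 3L^k·f`, so with `f = ε₀L^{−2k}`
the right-hand side is `12ε₀L^{−3k}(1 + 3ε₀)` plus the defect — print's scaling of the second member, chart-free.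

WHAT IS PROVED (sorry-free, no definition, standard axioms):
* §3 (every torus of `Setup`, any normed `ℂ`-algebra `𝔸`, units-valued `V` with `‖V(b)⁻¹‖ ≤ 1`): `norm_inv_mul_mul_sub_le` (`‖u⁻¹Yu − Y‖ ≤ 2‖u − 1‖‖Y‖`),
  **`abs_covDerivT_sub_diff_le`** (the backward covariant derivative of [Balaban1985RegularSpaces] (1.1) is a transverse difference up to `2‖V − 1‖·‖G − 1‖`),
  **`abs_bondAvgIter_covDivT_le`** (`|Q_k(ℓ∘D^{1*}_V∂V)(c)| ≤ (d − 1)·Λ·f·(2(L^k)⁻¹ + 2a)` for `|ℓ(Y)| ≤ Λ‖Y‖`).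
* §6 the d = 3 carrier of `T3Thm1Carrier.varProblem3 F n K`: **`abs_current_le_of_multiplier_T3`** — for EVERY unitary-valued `V`, every `ℓ` with
  `‖ℓ‖ ≤ 1`, every coarse `ω`: `|c²ℓ((D^{1*}_V∂V)(e)) − (Q*ω)(e)| ≤ p` at every bond ⇒ `|c²ℓ((D^{1*}_V∂V)(e))| ≤ 12c²f(c⁻¹ + a) + 4p`, `c = L^{K−n}`.
HONEST SCOPE.  An a-priori estimate in the currency of the Euler–Lagrange PORT (the defect `p` is the consumer's: `p = 0` for an exactly critical
configuration of the flat linearised problem; for print's critical configurations `p` is the distance of the true constraint force from the flat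
multiplier currents, owner ruling g22-№5 §E); it does NOT improve the plaquette member (that is the Green's-function analysis of Sects. C–F) and touches
no gauge fixing.  Not a claim about the mass gap; nothing of Bałaban's nonlinear analysis is asserted.

References: T. Bałaban, CMP **102** (1985) 277–309 [Balaban1985Variational] ((2) p.278, (127) p.297, (133)–(136) p.298, (158) p.302); CMP **95** (1984)
17–40 [Balaban1984PropagatorsI] ((1.18) p.20); CMP **99** (1985) 75–102 [Balaban1985RegularSpaces] ((1.1)–(1.2) p.76).
-/

set_option autoImplicit false

noncomputable section

open scoped BigOperators

namespace Summit.QuantumFields.YangMills.Theorems.Prop7CurrentSlaving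

open Literature.MathematicalPhysics.QuantumFieldTheory.Balaban1983to89
open Finset LatticeFieldCalculus B1RG242Torus

variable {P : Params}

/-! ## §3 The block average of a component of the covariant divergence of the curvature -/

section Covariant

variable {k : ℕ} {𝔸 : Type*} [NormedRing 𝔸] [NormedAlgebra ℂ 𝔸]

open B7Eq78Linearization (conjR conjR_apply)
open B10Eq68TorusRegularity (plaqFT covDerivT covDivT)

omit [NormedAlgebra ℂ 𝔸] in
/-- Conjugating by a unit `u` with `‖u⁻¹‖ ≤ 1` moves a matrix by at most `2‖u − 1‖·‖Y‖`: `u⁻¹Yu − Y = u⁻¹(Y(u − 1) − (u − 1)Y)`. [folklore] -/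
theorem norm_inv_mul_mul_sub_le (u : 𝔸ˣ) (hu : ‖((u⁻¹ : 𝔸ˣ) : 𝔸)‖ ≤ 1) (Y : 𝔸) :
    ‖((u⁻¹ : 𝔸ˣ) : 𝔸) * Y * (u : 𝔸) - Y‖ ≤ 2 * ‖(u : 𝔸) - 1‖ * ‖Y‖ := by
  have e : ((u⁻¹ : 𝔸ˣ) : 𝔸) * Y * (u : 𝔸) - Y = ((u⁻¹ : 𝔸ˣ) : 𝔸) * (Y * ((u : 𝔸) - 1) - ((u : 𝔸) - 1) * Y) := by
    have h1 : ((u⁻¹ : 𝔸ˣ) : 𝔸) * (u : 𝔸) = 1 := Units.inv_mul u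
    calc ((u⁻¹ : 𝔸ˣ) : 𝔸) * Y * (u : 𝔸) - Y
        = ((u⁻¹ : 𝔸ˣ) : 𝔸) * Y * (u : 𝔸) - ((u⁻¹ : 𝔸ˣ) : 𝔸) * (u : 𝔸) * Y := by rw [h1, one_mul]
      _ = ((u⁻¹ : 𝔸ˣ) : 𝔸) * (Y * ((u : 𝔸) - 1) - ((u : 𝔸) - 1) * Y) := by noncomm_ring
  rw [e]
  calc ‖((u⁻¹ : 𝔸ˣ) : 𝔸) * (Y * ((u : 𝔸) - 1) - ((u : 𝔸) - 1) * Y)‖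
      ≤ ‖((u⁻¹ : 𝔸ˣ) : 𝔸)‖ * ‖Y * ((u : 𝔸) - 1) - ((u : 𝔸) - 1) * Y‖ := norm_mul_le _ _
    _ ≤ 1 * (‖Y‖ * ‖(u : 𝔸) - 1‖ + ‖(u : 𝔸) - 1‖ * ‖Y‖) := by
        refine mul_le_mul hu ((norm_sub_le _ _).trans (add_le_add (norm_mul_le _ _) (norm_mul_le _ _))) (norm_nonneg _) zero_le_one
    _ = 2 * ‖(u : 𝔸) - 1‖ * ‖Y‖ := by ring

/-- **THE BACKWARD COVARIANT DERIVATIVE IS A TRANSVERSE DIFFERENCE UP TO A CONJUGATION DEFECT**: for a real component `ℓ` with `|ℓ(Y)| ≤ Λ‖Y‖`,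
`|ℓ((D^{1*}_{V,ν}G)(x)) − (ℓ(G(x − e_ν) − 1) − ℓ(G(x) − 1))| ≤ Λ·2‖V(x − e_ν, ν) − 1‖·‖G(x − e_ν) − 1‖` (`D^{1*}_ν` kills covariant constants).
[cite: Balaban1985RegularSpaces, (1.1) p.76] -/
theorem abs_covDerivT_sub_diff_le {s : ℕ} (V : GaugeField P s 𝔸ˣ) (ν : Fin P.d) (G : Site P s → 𝔸) (x : Site P s)
    (hVinv : ‖(((V ⟨x.unshift ν, ν⟩)⁻¹ : 𝔸ˣ) : 𝔸)‖ ≤ 1) (ℓ : 𝔸 →+ ℝ) {Λ : ℝ} (hΛ : 0 ≤ Λ) (hℓ : ∀ Y, |ℓ Y| ≤ Λ * ‖Y‖) :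
    |ℓ (covDerivT 1 V ν G x) - (ℓ (G (x.unshift ν) - 1) - ℓ (G x - 1))|
      ≤ Λ * (2 * ‖(V ⟨x.unshift ν, ν⟩ : 𝔸) - 1‖ * ‖G (x.unshift ν) - 1‖) := by
  set u : 𝔸ˣ := V ⟨x.unshift ν, ν⟩ with hu
  have hD : covDerivT 1 V ν G x = ((u⁻¹ : 𝔸ˣ) : 𝔸) * G (x.unshift ν) * (u : 𝔸) - G x := by
    rw [covDerivT, inv_one, one_smul, conjR_apply, inv_inv]
  have e : covDerivT 1 V ν G x
      = ((G (x.unshift ν) - 1) - (G x - 1)) + (((u⁻¹ : 𝔸ˣ) : 𝔸) * (G (x.unshift ν) - 1) * (u : 𝔸) - (G (x.unshift ν) - 1)) := by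
    rw [hD]
    have h1 : ((u⁻¹ : 𝔸ˣ) : 𝔸) * (u : 𝔸) = 1 := Units.inv_mul u
    have h2 : ((u⁻¹ : 𝔸ˣ) : 𝔸) * (G (x.unshift ν) - 1) * (u : 𝔸)
        = ((u⁻¹ : 𝔸ˣ) : 𝔸) * G (x.unshift ν) * (u : 𝔸) - ((u⁻¹ : 𝔸ˣ) : 𝔸) * (u : 𝔸) := by noncomm_ring
    rw [h2, h1]
    abel
  rw [e, map_add, map_sub, add_sub_cancel_left]
  exact (hℓ _).trans (mul_le_mul_of_nonneg_left (norm_inv_mul_mul_sub_le u hVinv _) hΛ)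

/-- The directions other than `μ` split into those below and those above. [folklore] -/
theorem erase_eq_Iio_union_Ioi (μ : Fin P.d) : (Finset.univ : Finset (Fin P.d)).erase μ = Finset.Iio μ ∪ Finset.Ioi μ := by
  ext ν
  simp only [Finset.mem_erase, Finset.mem_univ, and_true, Finset.mem_union, Finset.mem_Iio, Finset.mem_Ioi]
  exact ne_iff_lt_or_gt

/-- The directions below `μ` and above `μ` are disjoint. [folklore] -/
theorem disjoint_Iio_Ioi (μ : Fin P.d) : Disjoint (Finset.Iio μ) (Finset.Ioi μ) :=
  Finset.disjoint_left.2 fun ν h1 h2 => by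
    rw [Finset.mem_Iio] at h1
    rw [Finset.mem_Ioi] at h2
    exact lt_asymm h1 h2

/-- There are `d − 1` directions other than `μ`. [folklore] -/
theorem card_Iio_add_card_Ioi (μ : Fin P.d) : ((Finset.Iio μ).card : ℝ) + ((Finset.Ioi μ).card : ℝ) = (P.d : ℝ) - 1 := by
  have h := congrArg Finset.card (erase_eq_Iio_union_Ioi (P := P) μ)
  rw [Finset.card_union_of_disjoint (disjoint_Iio_Ioi μ), Finset.card_erase_of_mem (Finset.mem_univ _), Finset.card_univ,
    Fintype.card_fin] at h
  have h' : (((Finset.Iio μ).card + (Finset.Ioi μ).card : ℕ) : ℝ) = ((P.d - 1 : ℕ) : ℝ) := by exact_mod_cast h.symm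
  rw [Nat.cast_sub P.hd] at h'
  push_cast at h'
  linarith

/-- **THE STRAIGHT `k`-FOLD AVERAGE OF A COMPONENT OF THE YANG–MILLS CURRENT**: for a units-valued `V` on the finest torus with `‖V(b)⁻¹‖ ≤ 1`,
`‖V(b) − 1‖ ≤ a`, all plaquette variables within `f` of `1`, and a real component `ℓ` with `|ℓ(Y)| ≤ Λ‖Y‖`:
`|Q_k(ℓ∘D^{1*}_V∂V)(c)| ≤ (d − 1)·Λ·f·(2(L^k)⁻¹ + 2a)` at every coarse bond `c` — the covariant divergence ([Balaban1985RegularSpaces] (1.2)) is a sum of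
`d − 1` transverse differences of plaquette components plus conjugation defects `≤ 2af` each, and the differences telescope across the block.
[cite: Balaban1985RegularSpaces, (1.1)-(1.2) p.76; Balaban1984PropagatorsI, (1.18) p.20] -/
theorem abs_bondAvgIter_covDivT_le (hk : k ≤ P.m + P.K) (V : GaugeField P 0 𝔸ˣ) {a f Λ : ℝ} (hΛ : 0 ≤ Λ)
    (hVinv : ∀ b, ‖(((V b)⁻¹ : 𝔸ˣ) : 𝔸)‖ ≤ 1) (haV : ∀ b, ‖(V b : 𝔸) - 1‖ ≤ a)
    (hfV : ∀ (x : Site P 0) (κ μ : Fin P.d), ‖plaqFT V κ μ x - 1‖ ≤ f)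
    (ℓ : 𝔸 →+ ℝ) (hℓ : ∀ Y, |ℓ Y| ≤ Λ * ‖Y‖) (c : PBond P k) :
    |bondAvgIter k (fun b : PBond P 0 => ℓ (covDivT 1 V b.dir b.src)) c| ≤ ((P.d : ℝ) - 1) * Λ * f * (2 * ((P.L : ℝ) ^ k)⁻¹ + 2 * a) := by
  set μ : Fin P.d := c.dir with hμ
  -- the site functions: the plaquette components meeting the direction `μ`, signed as in (1.2)
  set g : Fin P.d → Site P 0 → ℝ := fun ν x => if ν < μ then ℓ (plaqFT V ν μ x - 1) else -ℓ (plaqFT V μ ν x - 1) with hg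
  have hG : ∀ ν x, |g ν x| ≤ Λ * f := by
    intro ν x
    simp only [hg]
    split_ifs
    · exact (hℓ _).trans (mul_le_mul_of_nonneg_left (hfV _ _ _) hΛ)
    · rw [abs_neg]; exact (hℓ _).trans (mul_le_mul_of_nonneg_left (hfV _ _ _) hΛ)
  -- the per-direction conjugation defects
  have hdef : ∀ (ν : Fin P.d) (G : Site P 0 → 𝔸) (x : Site P 0), (∀ z, ‖G z - 1‖ ≤ f) →
      |ℓ (covDerivT 1 V ν G x) - (ℓ (G (x.unshift ν) - 1) - ℓ (G x - 1))| ≤ Λ * (2 * a * f) := by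
    intro ν G x hGf
    refine (abs_covDerivT_sub_diff_le V ν G x (hVinv _) ℓ hΛ hℓ).trans (mul_le_mul_of_nonneg_left ?_ hΛ)
    have h1 := haV ⟨x.unshift ν, ν⟩
    have h2 := hGf (x.unshift ν)
    nlinarith [norm_nonneg ((V ⟨x.unshift ν, ν⟩ : 𝔸) - 1), norm_nonneg (G (x.unshift ν) - 1)]
  have hX : ∀ x : Site P 0, |ℓ (covDivT 1 V μ x) - ∑ ν ∈ (Finset.univ : Finset (Fin P.d)).erase μ, (g ν (x.unshift ν) - g ν x)|
      ≤ ((P.d : ℝ) - 1) * (Λ * (2 * a * f)) := by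
    intro x
    have hcov : ℓ (covDivT 1 V μ x) = ∑ ν ∈ Finset.Iio μ, ℓ (covDerivT 1 V ν (plaqFT V ν μ) x)
        - ∑ ν ∈ Finset.Ioi μ, ℓ (covDerivT 1 V ν (plaqFT V μ ν) x) := by
      rw [covDivT, map_sub, map_sum, map_sum]
    have hsplit : ∑ ν ∈ (Finset.univ : Finset (Fin P.d)).erase μ, (g ν (x.unshift ν) - g ν x)
        = ∑ ν ∈ Finset.Iio μ, (ℓ (plaqFT V ν μ (x.unshift ν) - 1) - ℓ (plaqFT V ν μ x - 1))
          - ∑ ν ∈ Finset.Ioi μ, (ℓ (plaqFT V μ ν (x.unshift ν) - 1) - ℓ (plaqFT V μ ν x - 1)) := by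
      rw [erase_eq_Iio_union_Ioi, Finset.sum_union (disjoint_Iio_Ioi μ), sub_eq_add_neg, ← Finset.sum_neg_distrib]
      congr 1
      · refine Finset.sum_congr rfl fun ν hν => ?_
        rw [Finset.mem_Iio] at hν
        simp only [hg, if_pos hν]
      · refine Finset.sum_congr rfl fun ν hν => ?_
        rw [Finset.mem_Ioi] at hν
        simp only [hg, if_neg (lt_asymm hν)]
        ring
    rw [hcov, hsplit]
    have e : ∑ ν ∈ Finset.Iio μ, ℓ (covDerivT 1 V ν (plaqFT V ν μ) x) - ∑ ν ∈ Finset.Ioi μ, ℓ (covDerivT 1 V ν (plaqFT V μ ν) x)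
        - (∑ ν ∈ Finset.Iio μ, (ℓ (plaqFT V ν μ (x.unshift ν) - 1) - ℓ (plaqFT V ν μ x - 1))
          - ∑ ν ∈ Finset.Ioi μ, (ℓ (plaqFT V μ ν (x.unshift ν) - 1) - ℓ (plaqFT V μ ν x - 1)))
        = ∑ ν ∈ Finset.Iio μ, (ℓ (covDerivT 1 V ν (plaqFT V ν μ) x) - (ℓ (plaqFT V ν μ (x.unshift ν) - 1) - ℓ (plaqFT V ν μ x - 1)))
          - ∑ ν ∈ Finset.Ioi μ, (ℓ (covDerivT 1 V ν (plaqFT V μ ν) x) - (ℓ (plaqFT V μ ν (x.unshift ν) - 1) - ℓ (plaqFT V μ ν x - 1))) := by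
      simp only [Finset.sum_sub_distrib]
      ring
    rw [e]
    refine (abs_sub _ _).trans ?_
    refine (add_le_add ((Finset.abs_sum_le_sum_abs _ _).trans (Finset.sum_le_sum fun ν _ => hdef ν _ x (fun z => hfV z ν μ)))
      ((Finset.abs_sum_le_sum_abs _ _).trans (Finset.sum_le_sum fun ν _ => hdef ν _ x (fun z => hfV z μ ν)))).trans ?_
    rw [Finset.sum_const, Finset.sum_const, nsmul_eq_mul, nsmul_eq_mul, ← add_mul, card_Iio_add_card_Ioi μ]
  have hmain := abs_bondAvgIter_le_of_transverseDiff hk (fun b : PBond P 0 => ℓ (covDivT 1 V b.dir b.src)) c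
    ((Finset.univ : Finset (Fin P.d)).erase μ) g hG hX
  have hcard : ((((Finset.univ : Finset (Fin P.d)).erase μ).card : ℕ) : ℝ) = (P.d : ℝ) - 1 := by
    rw [Finset.card_erase_of_mem (Finset.mem_univ _), Finset.card_univ, Fintype.card_fin, Nat.cast_sub P.hd]
    push_cast
    ring
  rw [hcard] at hmain
  refine hmain.trans (le_of_eq ?_)
  ring

end Covariant

/-! ## §6 At the d = 3 carrier, in the currency of the Euler–Lagrange port -/

section Carrier

open scoped Matrix.Norms.L2Operator
open T3ContinuumYM3Torus (T3Family)
open Summit.QuantumFields.YangMills.Theorems.Prop7FlatCoercivityR (succ_le_T3)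
open B6SectAOperatorsV1 B6SectCTwoScaleV1 B6GOneLevelV1Bridge
open B10Eq68TorusRegularity (plaqFT covDivT)
open B10Eq27TorusAxialLog (U1_of_unitaryUnits)
open B7Prop1Explicit (mem_U1)
open B7Prop2Explicit (unitaryUnits)

/-- **THE CURRENT IS SLAVED TO THE CURVATURE UNDER THE EULER–LAGRANGE PORT, d = 3 CARRIER** of `T3Thm1Carrier.varProblem3 F n K` (fine torus of run `K`,
`k = K − n`, `c = L^{K−n}`), in the currency of `Prop7FlatSliceRegularityGauge.exists_repr_abs_le_of_multiplier_T3`: let `V` be unitary-valued in ANY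
presentation (`‖V − 1‖ ≤ a`, all plaquette variables within `f` of `1`), `ℓ` a real component of norm `≤ 1`, and `ω` ANY coarse field with E–L ∕ port defect
`|c²·ℓ((D^{1*}_V∂V)(e)) − (Q*ω)(e)| ≤ p` at every fine bond.  Then `|c²·ℓ((D^{1*}_V∂V)(e))| ≤ 12·c²·f·(c⁻¹ + a) + 4p` at every fine bond: the divergence
member of [Balaban1985Variational] (2) for the component is bounded by `O(L^{−k} + a)` times the plaquette member plus the defect — uniformly in `m`, `n`,
`K` and the volume, no gauge condition, no Green's function.  (Block-axial presentations have `a ≤ 3L^k·f`; with `f = ε₀L^{−2k}` the bound reads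
`12ε₀L^{−3k}(1 + 3ε₀) + 4p·L^{…}` — print's scaling of the second member of (2).) [cite: Balaban1985Variational, (2) p.278, (127) p.297, (133) p.298, (158) p.302] -/
theorem abs_current_le_of_multiplier_T3 (F : T3Family) (n K : ℕ)
    (V : GaugeField (F.P K) 0 (Matrix (Fin 2) (Fin 2) ℂ)ˣ) (hV : ∀ b, V b ∈ unitaryUnits (Matrix (Fin 2) (Fin 2) ℂ))
    {a f : ℝ} (haV : ∀ b, ‖(V b : Matrix (Fin 2) (Fin 2) ℂ) - 1‖ ≤ a)
    (hfV : ∀ (s : Site (F.P K) 0) (κ μ : Fin 3), ‖plaqFT V κ μ s - 1‖ ≤ f)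
    (ℓ : Matrix (Fin 2) (Fin 2) ℂ →L[ℝ] ℝ) (hℓ : ‖ℓ‖ ≤ 1)
    (ω : BondIdxSpace (twoScale (K - n) (succ_le_T3 F n K) (∅ : Finset (Site (F.P K) (K - n + 1))))) {p : ℝ}
    (hω : ∀ e : PBond (F.P K) 0, |((F.L : ℝ) ^ (K - n)) ^ 2 * ℓ (covDivT 1 V e.dir e.src)
      - QsE (twoScale (K - n) (succ_le_T3 F n K) (∅ : Finset (Site (F.P K) (K - n + 1)))) ω e| ≤ p) :
    ∀ e : PBond (F.P K) 0, |((F.L : ℝ) ^ (K - n)) ^ 2 * ℓ (covDivT 1 V e.dir e.src)|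
      ≤ 12 * ((F.L : ℝ) ^ (K - n)) ^ 2 * f * (((F.L : ℝ) ^ (K - n))⁻¹ + a) + 4 * p := by
  set c : ℝ := (F.L : ℝ) ^ (K - n) with hc
  have hk : K - n ≤ (F.P K).m + (F.P K).K := Nat.le_of_succ_le (succ_le_T3 F n K)
  have hc0 : 0 < c := pow_pos (Nat.cast_pos.2 (F.P K).L_pos) _
  -- the scaled component as an additive map with `|ℓ′(Y)| ≤ c²‖Y‖`
  set ℓ' : Matrix (Fin 2) (Fin 2) ℂ →+ ℝ := (c ^ 2 • ℓ).toLinearMap.toAddMonoidHom with hℓ'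
  have hℓ'apply : ∀ Y, ℓ' Y = c ^ 2 * ℓ Y := fun Y => rfl
  have hℓ'bd : ∀ Y, |ℓ' Y| ≤ c ^ 2 * ‖Y‖ := by
    intro Y
    rw [hℓ'apply, abs_mul, abs_of_nonneg (by positivity : (0 : ℝ) ≤ c ^ 2)]
    refine mul_le_mul_of_nonneg_left ?_ (by positivity)
    have h1 : |ℓ Y| ≤ ‖ℓ‖ * ‖Y‖ := by rw [← Real.norm_eq_abs]; exact ℓ.le_opNorm Y
    nlinarith [norm_nonneg Y]
  -- `‖V(b)⁻¹‖ ≤ 1`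
  have hVinv : ∀ b, ‖(((V b)⁻¹ : (Matrix (Fin 2) (Fin 2) ℂ)ˣ) : Matrix (Fin 2) (Fin 2) ℂ)‖ ≤ 1 := by
    letI : CStarAlgebra (Matrix (Fin 2) (Fin 2) ℂ) := B10Eq29TubeLine.cstarAlgebraMatrix 2
    intro b
    exact (mem_U1.1 (U1_of_unitaryUnits hV b)).2
  -- the block averages of the scaled component of the current
  have hd : ((F.P K).d : ℝ) = 3 := by norm_num [show (F.P K).d = 3 from rfl]
  have hM : ∀ c' : PBond (F.P K) (K - n), |bondAvgIter (K - n) (fun b : PBond (F.P K) 0 => ℓ' (covDivT 1 V b.dir b.src)) c'|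
      ≤ 4 * c ^ 2 * f * (c⁻¹ + a) := by
    intro c'
    have h := abs_bondAvgIter_covDivT_le hk V (by positivity : (0 : ℝ) ≤ c ^ 2) hVinv haV hfV ℓ' hℓ'bd c'
    have hPL : (((F.P K).L : ℝ) ^ (K - n))⁻¹ = c⁻¹ := rfl
    rw [hd, hPL] at h
    refine h.trans (le_of_eq ?_)
    ring
  -- the port defect in tent-field form
  set W : PBond (F.P K) (K - n) → ℝ := fun c' => ω (bondIdxOfEmpty (succ_le_T3 F n K) c') with hW
  set A : PBond (F.P K) 0 → ℝ := fun b => (((F.L : ℝ) ^ (K - n)) ^ (F.P K).d * (F.L : ℝ) ^ (K - n))⁻¹ *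
        (((((b.src b.dir).val % F.L ^ (K - n) : ℕ) : ℝ) + 1) * W ⟨Site.proj (K - n) (K - n) b.src, b.dir⟩
          + ((F.L ^ (K - n) - 1 - (b.src b.dir).val % F.L ^ (K - n) : ℕ) : ℝ) * W ⟨(Site.proj (K - n) (K - n) b.src).unshift b.dir, b.dir⟩)
    with hAdef
  have hA : ∀ b : PBond (F.P K) 0, A b = ((((F.P K).L : ℝ) ^ (K - n)) ^ (F.P K).d * ((F.P K).L : ℝ) ^ (K - n))⁻¹ *
        (((((b.src b.dir).val % (F.P K).L ^ (K - n) : ℕ) : ℝ) + 1) * W ⟨Site.proj (K - n) (K - n) b.src, b.dir⟩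
          + (((F.P K).L ^ (K - n) - 1 - (b.src b.dir).val % (F.P K).L ^ (K - n) : ℕ) : ℝ)
            * W ⟨(Site.proj (K - n) (K - n) b.src).unshift b.dir, b.dir⟩) := fun b => rfl
  have hQs : ∀ e : PBond (F.P K) 0, QsE (twoScale (K - n) (succ_le_T3 F n K) (∅ : Finset (Site (F.P K) (K - n + 1)))) ω e = A e :=
    fun e => QsE_twoScale_empty_apply (succ_le_T3 F n K) ω e
  have hj : ∀ e : PBond (F.P K) 0, |ℓ' (covDivT 1 V e.dir e.src) - A e| ≤ p := by
    intro e
    rw [hℓ'apply, ← hQs e]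
    exact hω e
  intro e
  have h := abs_le_of_sub_adjField_le hk W A hA (fun b : PBond (F.P K) 0 => ℓ' (covDivT 1 V b.dir b.src)) hj hM e
  rw [hℓ'apply] at h
  refine h.trans (le_of_eq ?_)
  ring

/-- **NORM FORM**: if the port defect `p` is available for EVERY real component `ℓ` of norm `≤ 1` (each with its own candidate multiplier `ω_ℓ`), then the
full matrix norm of the scaled current obeys the same bound: `c²‖(D^{1*}_V∂V)(e)‖ ≤ 12c²f(c⁻¹ + a) + 4p` (Hahn–Banach: a norming functional of `J(e)`).
[cite: Balaban1985Variational, (2) p.278, (158) p.302] -/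
theorem norm_current_le_of_multiplier_T3 (F : T3Family) (n K : ℕ)
    (V : GaugeField (F.P K) 0 (Matrix (Fin 2) (Fin 2) ℂ)ˣ) (hV : ∀ b, V b ∈ unitaryUnits (Matrix (Fin 2) (Fin 2) ℂ))
    {a f : ℝ} (haV : ∀ b, ‖(V b : Matrix (Fin 2) (Fin 2) ℂ) - 1‖ ≤ a)
    (hfV : ∀ (s : Site (F.P K) 0) (κ μ : Fin 3), ‖plaqFT V κ μ s - 1‖ ≤ f) {p : ℝ}
    (hω : ∀ ℓ : Matrix (Fin 2) (Fin 2) ℂ →L[ℝ] ℝ, ‖ℓ‖ ≤ 1 →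
      ∃ ω : BondIdxSpace (twoScale (K - n) (succ_le_T3 F n K) (∅ : Finset (Site (F.P K) (K - n + 1)))),
        ∀ e : PBond (F.P K) 0, |((F.L : ℝ) ^ (K - n)) ^ 2 * ℓ (covDivT 1 V e.dir e.src)
          - QsE (twoScale (K - n) (succ_le_T3 F n K) (∅ : Finset (Site (F.P K) (K - n + 1)))) ω e| ≤ p) :
    ∀ e : PBond (F.P K) 0, ((F.L : ℝ) ^ (K - n)) ^ 2 * ‖covDivT 1 V e.dir e.src‖
      ≤ 12 * ((F.L : ℝ) ^ (K - n)) ^ 2 * f * (((F.L : ℝ) ^ (K - n))⁻¹ + a) + 4 * p := by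
  intro e
  obtain ⟨g, hg1, hgx⟩ := exists_dual_vector' ℝ (covDivT 1 V e.dir e.src)
  obtain ⟨ω, hωg⟩ := hω g hg1.le
  have h := abs_current_le_of_multiplier_T3 F n K V hV haV hfV g hg1.le ω hωg e
  have hgx' : g (covDivT 1 V e.dir e.src) = ‖covDivT 1 V e.dir e.src‖ := by simpa using hgx
  rw [hgx'] at h
  exact (le_abs_self _).trans h

end Carrier

end Summit.QuantumFields.YangMills.Theorems.Prop7CurrentSlaving

end
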